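import Summits.AtomisticToContinuum.BoseEinsteinCondensation.Theorems.BECGroundStateSOSPeriodicIRBoundWFKinematics
import Summits.AtomisticToContinuum.BoseEinsteinCondensation.Theorems.BECGroundStateSOSPeriodicIRBoundWFRegularity
import Summits.AtomisticToContinuum.BoseEinsteinCondensation.Theorems.BECDispersionLadderEndpointTransferOccupationFourier
import Literature.MathematicalPhysics.QuantumManyBody.PeriodicConfigFourier
import HarnessLib

/-!
# Crux `PeriodicIRBound` (stmt-AtomisticToContinuum-3972), line `fsum-phase-pencil`, helper S5
# `stub_fsumOccFourier` — Fourier-diagonal formulas for the occupation moments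

For a core (`C¹`, `Lℤ³`-periodic, Bose-symmetric) `N`-body function `Ψ` on the cell `[0,L)^{3N}` with full
Fourier coefficients `ĉ_ν(Ψ) = configFourierCoeff L Ψ ν`, `ν ∈ ℤ^{3N}`, and the first-quantised annihilation
operators `a_p = modeAn L (planeWaveMode L p)` of the normalised plane waves:

* `normSq_modeAn_eq_tsum_card` — `‖a_pΨ‖² = L^{3N} ∑_ν m_p(ν) |ĉ_ν(Ψ)|²`, `m_p(ν) = #{j : ν_j = p}` the
  multiplicity of the one-particle momentum `p` in `ν` (Parseval in the spectator variables,
  `cellOccupation_planeWaveMode_eq_tsum`, and Bose symmetry of the coefficients, `configFourierCoeff_perm`);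
* `normSq_modeAn_modeAn_eq_tsum_card` — `‖a_p a_qΨ‖² = L^{3N} ∑_ν m_q(ν) (m_p(ν) − δ_{pq}) |ĉ_ν(Ψ)|²`
  (the first formula for `a_qΨ`, whose coefficients are `ĉ_μ(a_qΨ) = √N L^{3/2} ĉ_{(q,μ)}(Ψ)`).

These are the number-operator moments `⟨N_p⟩` and `⟨N_q(N_p − δ_{pq})⟩` in the momentum representation.
-/

noncomputable section

open MeasureTheory Filter
open scoped ENNReal NNReal ComplexConjugate BigOperators

namespace Summit.AtomisticToContinuum.BoseEinsteinCondensation.Cruxes.PeriodicIRBound.FsumPhasePencil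

open Literature.MathematicalPhysics.QuantumManyBody.BoseGas
open Summit.AtomisticToContinuum.BoseEinsteinCondensation.Cruxes.PeriodicIRBound.LinearPhFloorWagner.WF
open Summit.AtomisticToContinuum.BoseEinsteinCondensation.Theorems.EndpointTransfer
  (configFourierCoeff_vecCons cellOccupation_planeWaveMode_eq_tsum natCast_mul_tsum_eq_tsum_sum_mul)
open Summit.AtomisticToContinuum.BoseEinsteinCondensation.Cruxes.StaticResponseBound.UvThomsonForceWave
  (configFourierCoeff_perm coe_nnnorm_real_mul_sq)

namespace OccFourier

variable {N n : ℕ} {L : ℝ}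

/-! ## Bookkeeping: boundedness, reindexing by the first slot, multiplicities -/

/-- A core function is globally bounded (it is continuous and periodic, so it takes all its values on the
compact closed box). [folklore] -/
theorem exists_norm_le_of_isCore (hL : 0 < L) {Ψ : Config N → ℂ} (hΨ : IsCore L Ψ) :
    ∃ C : ℝ, ∀ X, ‖Ψ X‖ ≤ C := by
  obtain ⟨C, hC⟩ := exists_bound_torusFunN hL hΨ.contDiff.continuous
  refine ⟨C, fun X => ?_⟩
  rw [← torusFunN_toUnitTorusN hL hΨ.periodic X]
  exact hC _

/-- Reindexing the frequencies with prescribed first slot: `∑_ν 1[ν₀ = q] b(ν) = ∑_m b(q, m)`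
(`ℤ^{3(n+1)} ≃ ℤ³ × ℤ^{3n}`). [folklore] -/
theorem tsum_ite_slot_zero_mul (q : Fin 3 → ℤ) (b : (Fin (n + 1) × Fin 3 → ℤ) → ℝ≥0∞) :
    ∑' ν : Fin (n + 1) × Fin 3 → ℤ, (if (fun c => ν (0, c)) = q then (1 : ℝ≥0∞) else 0) * b ν =
      ∑' m : Fin n × Fin 3 → ℤ, b (fun r : Fin (n + 1) × Fin 3 =>
        (Matrix.vecCons q (fun i k => m (i, k)) : Fin (n + 1) → Fin 3 → ℤ) r.1 r.2) := by
  set e : (Fin 3 → ℤ) × (Fin n × Fin 3 → ℤ) ≃ (Fin (n + 1) × Fin 3 → ℤ) :=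
    (Equiv.prodCongr (Equiv.refl (Fin 3 → ℤ)) (Equiv.curry (Fin n) (Fin 3) ℤ)).trans
      ((Fin.consEquiv (fun _ : Fin (n + 1) => Fin 3 → ℤ)).trans (Equiv.curry (Fin (n + 1)) (Fin 3) ℤ).symm)
    with he
  rw [← Equiv.tsum_eq e, ENNReal.tsum_prod']
  have h : ∀ (p : Fin 3 → ℤ) (m : Fin n × Fin 3 → ℤ),
      (if (fun c => e (p, m) (0, c)) = q then (1 : ℝ≥0∞) else 0) * b (e (p, m)) =
        if p = q then b (fun r : Fin (n + 1) × Fin 3 =>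
          (Matrix.vecCons p (fun i k => m (i, k)) : Fin (n + 1) → Fin 3 → ℤ) r.1 r.2) else 0 := by
    intro p m
    change (if p = q then (1 : ℝ≥0∞) else 0) * b (fun r : Fin (n + 1) × Fin 3 =>
      (Matrix.vecCons p (fun i k => m (i, k)) : Fin (n + 1) → Fin 3 → ℤ) r.1 r.2) = _
    split_ifs <;> simp
  simp only [h]
  rw [tsum_eq_single q (fun p hp => by simp only [if_neg hp, tsum_zero])]
  simp only [if_true]

/-- The multiplicity of `p` in `(q, μ)` is that in `μ`, plus one if `p = q`. [folklore] -/
theorem card_filter_vecCons (p q : Fin 3 → ℤ) (μ : Fin n × Fin 3 → ℤ) :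
    (Finset.univ.filter fun j : Fin (n + 1) => (fun c =>
        (Matrix.vecCons q (fun i k => μ (i, k)) : Fin (n + 1) → Fin 3 → ℤ) j c) = p).card =
      (Finset.univ.filter fun j : Fin n => (fun c => μ (j, c)) = p).card + if p = q then 1 else 0 := by
  rw [Finset.card_filter, Finset.card_filter, Fin.sum_univ_succ, add_comm]
  simp only [Matrix.cons_val_zero, Matrix.cons_val_succ]
  by_cases h : p = q
  · simp [h]
  · simp [h, Ne.symm h]

/-- The multiplicities are invariant under permuting the particle indices of the frequency. [folklore] -/
theorem card_filter_comp_perm (p : Fin 3 → ℤ) (σ : Equiv.Perm (Fin N)) (ν : Fin N × Fin 3 → ℤ) :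
    (Finset.univ.filter fun j : Fin N => (fun c => ν (σ j, c)) = p).card =
      (Finset.univ.filter fun j : Fin N => (fun c => ν (j, c)) = p).card := by
  rw [Finset.card_filter, Finset.card_filter]
  exact Equiv.sum_comp σ (fun j => if (fun c => ν (j, c)) = p then 1 else 0)

/-! ## `‖a_pΨ‖²` through the full coefficients -/

/-- **`‖a_pΨ‖²`, traced particle in slot `0`**: for a core `(n+1)`-body `Ψ`,
`‖a_pΨ‖² = (n+1) L^{3(n+1)} ∑_ν 1[ν₀ = p] |ĉ_ν(Ψ)|²` (Parseval in the spectators). [folklore] -/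
theorem normSq_modeAn_eq_tsum_ite (hL : 0 < L) (p : Fin 3 → ℤ) {Ψ : Config (n + 1) → ℂ}
    (hΨ : IsCore L Ψ) :
    normSq L (modeAn L (planeWaveMode L p) Ψ) =
      (n + 1 : ℝ≥0∞) * (ENNReal.ofReal L ^ 3) ^ (n + 1) *
        ∑' ν : Fin (n + 1) × Fin 3 → ℤ, (if (fun c => ν (0, c)) = p then (1 : ℝ≥0∞) else 0) *
          (‖configFourierCoeff L Ψ ν‖₊ : ℝ≥0∞) ^ 2 := by
  obtain ⟨C, hC⟩ := exists_norm_le_of_isCore hL hΨ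
  rw [normSq_modeAn hL p Ψ, cellOccupation_planeWaveMode_eq_tsum hL hΨ.contDiff.continuous hC p,
    tsum_ite_slot_zero_mul]

/-- **`‖a_pΨ‖² = L^{3N} ∑_ν m_p(ν) |ĉ_ν(Ψ)|²`** for a core `N = n+1`-body `Ψ`, `m_p(ν) = #{j : ν_j = p}`:
Bose symmetry spreads the traced particle over all slots. [folklore] -/
theorem normSq_modeAn_eq_tsum_card (hL : 0 < L) (p : Fin 3 → ℤ) {Ψ : Config (n + 1) → ℂ}
    (hΨ : IsCore L Ψ) :
    normSq L (modeAn L (planeWaveMode L p) Ψ) =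
      (ENNReal.ofReal L ^ 3) ^ (n + 1) * ∑' ν : Fin (n + 1) × Fin 3 → ℤ,
        ((Finset.univ.filter fun j : Fin (n + 1) => (fun c => ν (j, c)) = p).card : ℝ≥0∞) *
          (‖configFourierCoeff L Ψ ν‖₊ : ℝ≥0∞) ^ 2 := by
  have hsymm := natCast_mul_tsum_eq_tsum_sum_mul (n := n) (fun k : Fin 3 → ℤ => if k = p then (1 : ℝ≥0∞) else 0)
    (a := fun ν : Fin (n + 1) × Fin 3 → ℤ => (‖configFourierCoeff L Ψ ν‖₊ : ℝ≥0∞) ^ 2)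
    (fun σ ν => by rw [configFourierCoeff_perm hΨ.symm σ ν])
  simp only [Finset.sum_boole] at hsymm
  rw [normSq_modeAn_eq_tsum_ite hL p hΨ, mul_comm (n + 1 : ℝ≥0∞), mul_assoc, hsymm]

/-! ## `‖a_p a_qΨ‖²` through the full coefficients -/

/-- `∫_Ω conj(φ_q) f = L^{3/2} ĉ_q(f)` (`φ_q = L^{-3/2} e_q`, `ĉ_q(f) = L⁻³ ∫_Ω conj(e_q) f`). [folklore] -/
theorem integral_conj_planeWaveMode_mul_eq (hL : 0 < L) (q : Fin 3 → ℤ) (f : Space → ℂ) :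
    ∫ x in cell L, conj (planeWaveMode L q x) * f x = (Real.sqrt (L ^ 3) : ℂ) * cellFourierCoeff L f q := by
  have h3 : (0 : ℝ) < L ^ 3 := by positivity
  have hfun : (fun x => conj (planeWaveMode L q x) * f x) =
      fun x => ((Real.sqrt (L ^ 3) : ℂ))⁻¹ * (conj (cellWave L q x) * f x) := by
    funext x
    rw [planeWaveMode_eq, map_mul, mul_assoc, map_inv₀, Complex.conj_ofReal]
  rw [hfun, integral_const_mul, cellFourierCoeff_eq_integral hL, Complex.real_smul, ← mul_assoc]
  congr 1
  have hr : (Real.sqrt (L ^ 3))⁻¹ = Real.sqrt (L ^ 3) * (L ^ 3)⁻¹ := by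
    rw [← div_eq_mul_inv, Real.sqrt_div_self']
    rw [one_div]
  rw [← Complex.ofReal_inv, hr, Complex.ofReal_mul]

/-- `a_qΨ = √(n+2) L^{3/2} · (Y ↦ ĉ_q(Ψ(·, Y)))` for an `(n+2)`-body `Ψ`. [folklore] -/
theorem modeAn_planeWaveMode_eq_sliceCoeff (hL : 0 < L) (q : Fin 3 → ℤ) (Ψ : Config (n + 2) → ℂ) :
    modeAn L (planeWaveMode L q) Ψ = fun Y : Config (n + 1) =>
      ((Real.sqrt (n + 2) * Real.sqrt (L ^ 3) : ℝ) : ℂ) *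
        cellFourierCoeff L (fun x => Ψ (Matrix.vecCons x Y)) q := by
  funext Y
  rw [modeAn_apply, integral_conj_planeWaveMode_mul_eq hL, ← mul_assoc, Complex.ofReal_mul]
  push_cast
  ring_nf

/-- The Fourier coefficients are linear: `ĉ_ν(c f) = c ĉ_ν(f)`. [folklore] -/
theorem configFourierCoeff_const_mul_left (L : ℝ) (c : ℂ) (f : Config N → ℂ) (ν : Fin N × Fin 3 → ℤ) :
    configFourierCoeff L (fun X => c * f X) ν = c * configFourierCoeff L f ν := by
  unfold configFourierCoeff UnitAddTorus.mFourierCoeff torusFunN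
  rw [← integral_const_mul]
  simp only [smul_eq_mul, mul_left_comm _ c]

/-- **The coefficients of `a_qΨ`**: `|ĉ_μ(a_qΨ)|² = (n+2) L³ |ĉ_{(q,μ)}(Ψ)|²` for a continuous bounded
`(n+2)`-body `Ψ`. [folklore] -/
theorem nnnorm_sq_configFourierCoeff_modeAn (hL : 0 < L) (q : Fin 3 → ℤ) {Ψ : Config (n + 2) → ℂ}
    (hΨc : Continuous Ψ) {C : ℝ} (hbd : ∀ X, ‖Ψ X‖ ≤ C) (μ : Fin (n + 1) × Fin 3 → ℤ) :
    (‖configFourierCoeff L (modeAn L (planeWaveMode L q) Ψ) μ‖₊ : ℝ≥0∞) ^ 2 =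
      (n + 2 : ℝ≥0∞) * ENNReal.ofReal L ^ 3 * (‖configFourierCoeff L Ψ (fun r : Fin (n + 2) × Fin 3 =>
        (Matrix.vecCons q (fun i k => μ (i, k)) : Fin (n + 2) → Fin 3 → ℤ) r.1 r.2)‖₊ : ℝ≥0∞) ^ 2 := by
  rw [modeAn_planeWaveMode_eq_sliceCoeff hL q Ψ, configFourierCoeff_const_mul_left,
    ← configFourierCoeff_vecCons hL hΨc hbd q μ, coe_nnnorm_real_mul_sq (by positivity)]
  congr 1
  rw [mul_pow, Real.sq_sqrt (by positivity), Real.sq_sqrt (by positivity),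
    ENNReal.ofReal_mul (by positivity), ENNReal.ofReal_pow hL.le]
  congr 1
  have h : (n + 2 : ℝ) = ((n + 2 : ℕ) : ℝ) := by push_cast; ring
  rw [h, ENNReal.ofReal_natCast]
  push_cast
  ring

/-- **`‖a_p a_qΨ‖² = L^{3N} ∑_ν m_q(ν) (m_p(ν) − δ_{pq}) |ĉ_ν(Ψ)|²`** for a core `N = n+2`-body `Ψ`. [folklore] -/
theorem normSq_modeAn_modeAn_eq_tsum_card (hL : 0 < L) (p q : Fin 3 → ℤ) {Ψ : Config (n + 2) → ℂ}
    (hΨ : IsCore L Ψ) :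
    normSq L (modeAn L (planeWaveMode L p) (modeAn L (planeWaveMode L q) Ψ)) =
      (ENNReal.ofReal L ^ 3) ^ (n + 2) * ∑' ν : Fin (n + 2) × Fin 3 → ℤ,
        (((Finset.univ.filter fun j : Fin (n + 2) => (fun c => ν (j, c)) = q).card : ℝ≥0∞) *
          (((Finset.univ.filter fun j : Fin (n + 2) => (fun c => ν (j, c)) = p).card : ℝ≥0∞) -
            if p = q then 1 else 0)) *
          (‖configFourierCoeff L Ψ ν‖₊ : ℝ≥0∞) ^ 2 := by
  obtain ⟨C, hC⟩ := exists_norm_le_of_isCore hL hΨ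
  have hΨc : Continuous Ψ := hΨ.contDiff.continuous
  have hΦ : IsCore L (modeAn L (planeWaveMode L q) Ψ) := isCore_modeAn hL q hΨ
  -- symmetrisation of the right-hand side (traced particle `q` in slot `0`)
  have hsymm := natCast_mul_tsum_eq_tsum_sum_mul (n := n + 1)
    (fun k : Fin 3 → ℤ => if k = q then (1 : ℝ≥0∞) else 0)
    (a := fun ν : Fin (n + 2) × Fin 3 → ℤ =>
      (((Finset.univ.filter fun j : Fin (n + 2) => (fun c => ν (j, c)) = p).card : ℝ≥0∞) -
          if p = q then 1 else 0) * (‖configFourierCoeff L Ψ ν‖₊ : ℝ≥0∞) ^ 2)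
    (fun σ ν => by
      simp only []
      rw [configFourierCoeff_perm hΨ.symm σ ν, card_filter_comp_perm p σ ν])
  simp only [Finset.sum_boole] at hsymm
  have hB := tsum_ite_slot_zero_mul (n := n + 1) q (fun ν : Fin (n + 2) × Fin 3 → ℤ =>
      (((Finset.univ.filter fun j : Fin (n + 2) => (fun c => ν (j, c)) = p).card : ℝ≥0∞) -
          if p = q then 1 else 0) * (‖configFourierCoeff L Ψ ν‖₊ : ℝ≥0∞) ^ 2)
  simp only [card_filter_vecCons p q, Nat.cast_add, Nat.cast_ite, Nat.cast_one, Nat.cast_zero] at hB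
  have hδ : (if p = q then (1 : ℝ≥0∞) else 0) ≠ ⊤ := by split_ifs <;> simp
  simp only [ENNReal.add_sub_cancel_right hδ] at hB
  have h2 : ((n + 1 : ℕ) : ℝ≥0∞) + 1 = (n + 2 : ℝ≥0∞) := by push_cast; ring
  rw [h2, hB] at hsymm
  -- left-hand side: the first formula for `a_qΨ`, then the coefficients of `a_qΨ`
  rw [normSq_modeAn_eq_tsum_card hL p hΦ]
  simp only [nnnorm_sq_configFourierCoeff_modeAn hL q hΨc hC]
  simp only [mul_assoc] at hsymm ⊢
  rw [← hsymm, ← ENNReal.tsum_mul_left, ← ENNReal.tsum_mul_left, ← ENNReal.tsum_mul_left]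
  refine tsum_congr fun μ => ?_
  rw [pow_succ]
  ring

end OccFourier

/-- **Registered helper sub-goal `stub_fsumOccFourier`** (line `fsum-phase-pencil`, S5): the Fourier-diagonal
formulas `‖a_pΨ‖² = L^{3N} ∑_ν m_p(ν)|ĉ_ν|²` and `‖a_p a_qΨ‖² = L^{3N} ∑_ν m_q(ν)(m_p(ν) − δ_{pq})|ĉ_ν|²` for core
functions (`OccFourier.normSq_modeAn_eq_tsum_card`, `OccFourier.normSq_modeAn_modeAn_eq_tsum_card`). [folklore] -/
theorem stub_fsumOccFourier :
    (∀ {n : ℕ} {L : ℝ}, 0 < L → ∀ (p : Fin 3 → ℤ) {Ψ : Config (n + 1) → ℂ}, IsCore L Ψ →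
      normSq L (modeAn L (planeWaveMode L p) Ψ) =
        (ENNReal.ofReal L ^ 3) ^ (n + 1) * ∑' ν : Fin (n + 1) × Fin 3 → ℤ,
          ((Finset.univ.filter fun j : Fin (n + 1) => (fun c => ν (j, c)) = p).card : ℝ≥0∞) *
            (‖configFourierCoeff L Ψ ν‖₊ : ℝ≥0∞) ^ 2) ∧
    (∀ {n : ℕ} {L : ℝ}, 0 < L → ∀ (p q : Fin 3 → ℤ) {Ψ : Config (n + 2) → ℂ}, IsCore L Ψ →
      normSq L (modeAn L (planeWaveMode L p) (modeAn L (planeWaveMode L q) Ψ)) =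
        (ENNReal.ofReal L ^ 3) ^ (n + 2) * ∑' ν : Fin (n + 2) × Fin 3 → ℤ,
          (((Finset.univ.filter fun j : Fin (n + 2) => (fun c => ν (j, c)) = q).card : ℝ≥0∞) *
            (((Finset.univ.filter fun j : Fin (n + 2) => (fun c => ν (j, c)) = p).card : ℝ≥0∞) -
              if p = q then 1 else 0)) *
            (‖configFourierCoeff L Ψ ν‖₊ : ℝ≥0∞) ^ 2) :=
  ⟨fun hL p _ hΨ => OccFourier.normSq_modeAn_eq_tsum_card hL p hΨ,
    fun hL p q _ hΨ => OccFourier.normSq_modeAn_modeAn_eq_tsum_card hL p q hΨ⟩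

end Summit.AtomisticToContinuum.BoseEinsteinCondensation.Cruxes.PeriodicIRBound.FsumPhasePencil

end
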